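import Literature.MathematicalPhysics.QuantumLattice.ReflectedCorrelationTranslates
import Summits.QuantumFields.YangMills.Theorems.ParabolicTrajectoryLatticeGapOnTrajectoryTransferHankelSiteStrict
import Summits.QuantumFields.YangMills.Theorems.ParabolicTrajectoryLatticeGapOnTrajectoryStubNegReflectRP
import HarnessLib

/-!
# Crux `GapToContinuum` (stmt-QuantumFields-8896): the one-leg far bound from ONE certified pair

`--supports stmt-QuantumFields-8896` (route `LangevinControlUV`, sub-problem `YangMills`; line lead c10).

The typed crux (`IsYangMillsFor r sch T → HasLatticeMassGap r sch Δ → T.HasMassGap Δ`) is misstated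
as typed (`Cruxes/GapToContinuum/STRATEGY-CENSUS.md`): its hypothesis certifies clustering PER PAIR
of fixed lattice-local observables (`∀ A B ∃ C ∀ᶠ k`), while a smeared continuum leg at step `k` is
a `k`-growing linear combination of translates.  The census (§1 D2, §Decomposition D₃) records that
this defect "already bites inside ONE smeared leg through the spatial pairs `(O, O∘τ_z)`".  This
file proves that it does NOT, on the odd torus at `0 ≤ β`: reflection-positivity Cauchy–Schwarz at
the separations `(0, 2n)` collapses every cross pair of space-time translates of one slab observable
`O` onto the DIAGONAL pair `(O, O)` at the same rate, so ONE pair's clustering controls every finite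
combination of translates of `O` — in particular the smeared renormalised leg of a species:

* (abstract bookkeeping in `Literature/…/QuantumLattice/ReflectedCorrelationTranslates`: `osCorr_comp_comp_eq_of_comm`,
  `osCorr_iterate_comp_iterate`, the POLARISED Cauchy–Schwarz inequality at separations `(0, 2m)`
  `norm_osCorr_iterate_sq_le`, sesquilinearity `osCorr_sum_sum`);
* here (the odd Wilson torus, site reflection `Θ₀ = GaugeConfig.negReflect`, `τ_m = torusTimeShift`;
  `Θ₀` commutes with SPATIAL translations, `negReflect_torusConfigShift_spatial`):
  **`norm_osCorr_combination_le`** — for a bounded measurable `O` depending on the links based at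
  times `1 … w`, spatial translations `v_i` (`v_i 0 = 0`), forward time shifts `s_i ≤ s̄`,
  coefficients `a_i` and `X = Σ_i a_i • (O ∘ torusConfigShift v_i ∘ τ_{s_i})`: if the single pair
  `(O, O)` satisfies `‖osCorr μ Θ₀ τ_n O O‖ ≤ C e^{−κ n}` for `n ≤ 2(m + 2 s̄)` (`2(m + 2 s̄) + w < S`),
  then `‖osCorr μ Θ₀ τ_m X X‖ ≤ (Σ_i ‖a_i‖)² C e^{−κ m}`;
  `norm_osCorr_combination_le_of_nonneg` discharges reflection positivity at `0 ≤ β` by the landed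
  odd-torus site RP `stub_negReflectRP`.

For the renormalised smeared field of a species `s` against a test function `p` this is the
whole-range far bound with constant `(|c_s(k)| a_k⁴ Σ_x |p(a_k x)|)² · C_s`, `C_s` the
`HasLatticeMassGap` constant of the one pair `(s.timeReflect, s)` (sequel file).  Consequence for
the defect map of the crux: in the ONE-LEG sector the typed hypothesis fails to transfer only
through D1 (`0 ≤ β_k`, free under `HasWeakCouplingLimit`) and D3b (the Hankel-chain loss factor
`((Σ‖a‖)² C / osVar X)^{2^{-J}}`, i.e. `log |c_s(k)| = o(a_k L_k)`, untyped); the irreducible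
per-pair-threshold defect D2 lives in the multi-leg product family only
(`Negative/HeavyProductLeak`, p120725).  The same lemma is what a producer-side prover (re-typed
stmt-16207, scheme existential) uses to turn per-pair clustering with a uniform threshold into the
diagonal OS-currency bound `sch.HasDiagClustering r Δ` (R5 of the census).

References: Osterwalder–Seiler 1978 §2; Glimm–Jaffe 1987 §6.1; Fröhlich–Israel–Lieb–Simon 1978 §2
(Schwarz inequality for RP states).
-/

open scoped ComplexConjugate ComplexOrder
open Filter MeasureTheory Finset
open Literature.MathematicalPhysics.QuantumLattice Literature.MathematicalPhysics.QuantumFieldTheory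
open Summit.QuantumFields.YangMills.Cruxes.LatticeGapOnTrajectory.OrbitKantorovichFiniteSize.Transfer

noncomputable section

namespace Summit.QuantumFields.YangMills.Theorems.GapToContinuum.OneLeg

/-! ## §2 The odd Wilson torus: spatial translations, and the far bound for a combination of translates -/

section Torus

variable {G : Type} [Group G] [TopologicalSpace G] [IsTopologicalGroup G] [CompactSpace G]
  [MeasurableSpace G] [BorelSpace G] {N : ℕ} (ρ : G →* Matrix (Fin N) (Fin N) ℂ)

section Geometry

variable {Sd : ℕ}

omit [TopologicalSpace G] [IsTopologicalGroup G] [CompactSpace G] [MeasurableSpace G] [BorelSpace G] in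
/-- A SPATIAL translation (`v 0 = 0`) commutes with the site reflection of sites. -/
theorem negReflect_sub_spatial [NeZero Sd] (x v : Site 4 Sd) (hv : v 0 = 0) :
    (x - v).negReflect = x.negReflect - v := by
  funext k
  by_cases hk : k = 0
  · subst hk
    simp only [WilsonSiteRP.negReflect_apply_zero, Pi.sub_apply, hv, sub_zero]
  · simp only [WilsonSiteRP.negReflect_apply_of_ne _ hk, Pi.sub_apply]

omit [TopologicalSpace G] [IsTopologicalGroup G] [CompactSpace G] [MeasurableSpace G] [BorelSpace G] in
/-- A spatial translation commutes with `x ↦ θ₀(x + e₀)`. -/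
theorem negReflect_shift_sub_spatial [NeZero Sd] (x v : Site 4 Sd) (hv : v 0 = 0) :
    ((x - v).shift 0).negReflect = (x.shift 0).negReflect - v := by
  have h : (x - v).shift 0 = x.shift 0 - v := by
    simp only [Site.shift]; abel
  rw [h, negReflect_sub_spatial _ _ hv]

omit [TopologicalSpace G] [IsTopologicalGroup G] [CompactSpace G] [BorelSpace G] in
/-- **The site reflection commutes with spatial translations** of torus configurations:
`Θ₀ (torusConfigShift v U) = torusConfigShift v (Θ₀ U)` for `v 0 = 0`. -/
theorem negReflect_torusConfigShift_spatial [NeZero Sd] (v : Site 4 Sd) (hv : v 0 = 0)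
    (U : GaugeConfig 4 Sd G) :
    (torusConfigShift v U).negReflect = torusConfigShift v U.negReflect := by
  funext e
  obtain ⟨x, i⟩ := e
  rw [torusConfigShift_apply, WilsonSiteRP.negReflect_apply, WilsonSiteRP.negReflect_apply]
  unfold WilsonSiteRP.siteEdgeReflect
  by_cases hi : i = 0
  · simp only [hi, ↓reduceIte, torusConfigShift_apply, negReflect_shift_sub_spatial _ _ hv]
  · simp only [hi, ↓reduceIte, torusConfigShift_apply, negReflect_sub_spatial _ _ hv]

omit [Group G] [TopologicalSpace G] [IsTopologicalGroup G] [CompactSpace G] [BorelSpace G] in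
/-- Torus translations commute. -/
theorem torusConfigShift_comm [NeZero Sd] (v v' : Site 4 Sd) (U : GaugeConfig 4 Sd G) :
    torusConfigShift v (torusConfigShift v' U) = torusConfigShift v' (torusConfigShift v U) := by
  funext e
  simp only [torusConfigShift_apply, sub_sub, add_comm]

omit [Group G] [TopologicalSpace G] [IsTopologicalGroup G] [CompactSpace G] [BorelSpace G] in
/-- Time shifts commute with every torus translation. -/
theorem torusTimeShift_torusConfigShift [NeZero Sd] (n : ℕ) (v : Site 4 Sd) (U : GaugeConfig 4 Sd G) :
    torusTimeShift Sd n (torusConfigShift v U) = torusConfigShift v (torusTimeShift Sd n U) := by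
  unfold torusTimeShift
  exact torusConfigShift_comm _ _ U

omit [Group G] [TopologicalSpace G] [IsTopologicalGroup G] [CompactSpace G] [BorelSpace G] in
/-- A spatially translated slab observable is a slab observable of the same slab. -/
theorem dependsOn_comp_torusConfigShift_spatial [NeZero Sd] {α : Type*} {X : GaugeConfig 4 Sd G → α}
    {a b : ℕ} (hX : DependsOn X {e : Edge 4 Sd | a ≤ (e.1 0).val ∧ (e.1 0).val ≤ b})
    (v : Site 4 Sd) (hv : v 0 = 0) :
    DependsOn (X ∘ torusConfigShift v) {e : Edge 4 Sd | a ≤ (e.1 0).val ∧ (e.1 0).val ≤ b} := by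
  intro U V hUV
  simp only [Function.comp_apply]
  apply hX
  intro e he
  rw [torusConfigShift_apply, torusConfigShift_apply]
  apply hUV
  simp only [Set.mem_setOf_eq, Pi.sub_apply, hv, sub_zero] at he ⊢
  exact he

end Geometry

section Main

variable {S : ℕ}

/-- **The far bound for a finite combination of translates from ONE pair's clustering.**
Let `μ = wilsonMeasure ρ β` on `GaugeConfig 4 (2S+1) G`, `Θ₀ = GaugeConfig.negReflect`,
`τ_n = torusTimeShift (2S+1) n`, and assume site reflection positivity on slab observables (raw
strict form of `stub_negReflectRP`).  Let `O` be bounded measurable depending only on the links based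
at lattice times `1 … w`, and let `X = Σ_{i ∈ t} a_i • (O ∘ torusConfigShift v_i ∘ τ_{s_i})` be a
finite combination of its SPATIAL translates (`v_i 0 = 0`) shifted forward in time by `s_i ≤ s̄`.
If the single pair `(O, O)` clusters, `‖osCorr μ Θ₀ τ_n O O‖ ≤ C e^{−κ n}` for all `n ≤ 2(m + 2 s̄)`
(`C, κ ≥ 0`, `2(m + 2 s̄) + w < S`), then
`‖osCorr μ Θ₀ τ_m X X‖ ≤ (Σ_i ‖a_i‖)² · C · e^{−κ m}`.
Mechanism: sesquilinear expansion; each cross term `osCorr τ_m (Z_i ∘ τ_{s_i}) (Z_j ∘ τ_{s_j}) =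
osCorr τ_{m + s_i + s_j} Z_i Z_j` is bounded by the polarised RP Cauchy–Schwarz at separations
`(0, 2(m + s_i + s_j))`, `√(osVar Z_i · Re osCorr τ_{2(m+s_i+s_j)} Z_j Z_j)`, and spatial translation
invariance of the torus state identifies both factors with the diagonal pair `(O, O)`. -/
theorem norm_osCorr_combination_le (hρ : Continuous ρ) (β : ℝ)
    (hRP : ∀ (F : GaugeConfig 4 (2 * S + 1) G → ℂ), Measurable F → (∃ C : ℝ, ∀ U, ‖F U‖ ≤ C) →
      ∀ {w : ℕ}, w < S → DependsOn F {e : Edge 4 (2 * S + 1) | 1 ≤ (e.1 0).val ∧ (e.1 0).val ≤ w} →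
        0 ≤ wilsonExpectation ρ β fun U => conj (F U.negReflect) * F U)
    {O : GaugeConfig 4 (2 * S + 1) G → ℂ} (hO : Measurable O) (hOb : ∃ B, ∀ U, ‖O U‖ ≤ B) {w : ℕ}
    (hOd : DependsOn O {e : Edge 4 (2 * S + 1) | 1 ≤ (e.1 0).val ∧ (e.1 0).val ≤ w})
    {ι : Type*} (t : Finset ι) (a : ι → ℂ) (v : ι → Site 4 (2 * S + 1)) (hv : ∀ i ∈ t, v i 0 = 0)
    (s : ι → ℕ) {smax : ℕ} (hs : ∀ i ∈ t, s i ≤ smax) {C κ : ℝ} (hC : 0 ≤ C) (hκ : 0 ≤ κ) {m : ℕ}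
    (hrange : 2 * (m + 2 * smax) + w < S)
    (hpair : ∀ n, n ≤ 2 * (m + 2 * smax) →
      ‖osCorr (wilsonMeasure (d := 4) (L := 2 * S + 1) ρ β) GaugeConfig.negReflect
          (torusTimeShift (2 * S + 1) n) O O‖ ≤ C * Real.exp (-(κ * n))) :
    ‖osCorr (wilsonMeasure (d := 4) (L := 2 * S + 1) ρ β) GaugeConfig.negReflect
        (torusTimeShift (2 * S + 1) m)
        (∑ i ∈ t, a i • (O ∘ torusConfigShift (v i) ∘ torusTimeShift (2 * S + 1) (s i)))
        (∑ i ∈ t, a i • (O ∘ torusConfigShift (v i) ∘ torusTimeShift (2 * S + 1) (s i)))‖ ≤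
      (∑ i ∈ t, ‖a i‖) ^ 2 * C * Real.exp (-(κ * m)) := by
  set μ := wilsonMeasure (d := 4) (L := 2 * S + 1) (G := G) ρ β with hμ
  haveI := isProbabilityMeasure_wilsonMeasure (d := 4) (L := 2 * S + 1) ρ hρ β
  have hΘm : Measurable (GaugeConfig.negReflect : GaugeConfig 4 (2 * S + 1) G → _) :=
    WilsonSiteRP.measurable_negReflect
  have hΘ : MeasurePreserving (GaugeConfig.negReflect : GaugeConfig 4 (2 * S + 1) G → _) μ μ :=
    measurePreserving_negReflect_wilsonMeasure ρ hρ β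
  have hΘΘ : ∀ U : GaugeConfig 4 (2 * S + 1) G, U.negReflect.negReflect = U :=
    WilsonSiteRP.negReflect_negReflect_config
  have hτ : MeasurePreserving (⇑(torusTimeShift (G := G) (2 * S + 1) 1)) μ μ :=
    ⟨(torusTimeShift _ _).measurable, by
      unfold torusTimeShift; exact wilsonMeasure_map_torusConfigShift ρ β _⟩
  set σ : GaugeConfig 4 (2 * S + 1) G → GaugeConfig 4 (2 * S + 1) G :=
    ⇑(torusConfigShift (G := G) (Pi.single 0 (1 : ZMod (2 * S + 1)) : Site 4 (2 * S + 1))) with hσdef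
  have hσ : Measurable σ := (torusConfigShift _).measurable
  have hΘτ : ∀ U : GaugeConfig 4 (2 * S + 1) G,
      torusTimeShift (2 * S + 1) 1 U.negReflect = (σ U).negReflect := by
    intro U
    rw [Hankel.coe_torusTimeShift_one]
    have h := HankelSite.torusConfigShift_negReflect_comm (G := G) (-1 : ZMod (2 * S + 1)) U
    rw [Pi.single_neg, neg_neg] at h
    exact h
  have hστ : ∀ U : GaugeConfig 4 (2 * S + 1) G, σ (torusTimeShift (2 * S + 1) 1 U) = U := by
    intro U
    rw [Hankel.coe_torusTimeShift_one]
    exact Summit.QuantumFields.YangMills.Theorems.FiniteSusceptibilityWeakCoupling.RPCauchySchwarz.torusConfigShift_shift_neg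
      (Pi.single 0 1) U
  -- the reflection-positive class: bounded measurable observables of the slab `1 … S − 1`
  set Good : (GaugeConfig 4 (2 * S + 1) G → ℂ) → Prop := fun Z => Measurable Z ∧ (∃ B, ∀ U, ‖Z U‖ ≤ B) ∧
    DependsOn Z {e : Edge 4 (2 * S + 1) | 1 ≤ (e.1 0).val ∧ (e.1 0).val ≤ S - 1} with hGood
  have hmeas : ∀ Z, Good Z → Measurable Z := fun Z h => h.1
  have hbdd : ∀ Z, Good Z → ∃ B, ∀ U, ‖Z U‖ ≤ B := fun Z h => h.2.1
  have hadd : ∀ Z Y (c : ℂ), Good Z → Good Y → Good (Z + c • Y) := by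
    rintro Z Y c ⟨hZm, ⟨BZ, hBZ⟩, hZd⟩ ⟨hYm, ⟨BY, hBY⟩, hYd⟩
    refine ⟨hZm.add (hYm.const_smul c), ⟨BZ + ‖c‖ * BY, fun U => ?_⟩, fun U V h => ?_⟩
    · rw [Pi.add_apply, Pi.smul_apply, smul_eq_mul]
      refine (norm_add_le _ _).trans (add_le_add (hBZ U) ?_)
      rw [norm_mul]
      exact mul_le_mul_of_nonneg_left (hBY U) (norm_nonneg _)
    · simp only [Pi.add_apply, Pi.smul_apply, smul_eq_mul]
      rw [hZd h, hYd h]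
  have hvar : ∀ Z, Good Z → 0 ≤ osVar μ GaugeConfig.negReflect Z := fun Z h =>
    HankelSite.osVar_negReflect_nonneg_of_rp_lt ρ hρ β hRP h.1 h.2.1 (by omega) h.2.2
  -- the spatial translates `Z i = O ∘ shift (v i)` and their forward time shifts
  obtain ⟨B, hB⟩ := hOb
  set Z : ι → GaugeConfig 4 (2 * S + 1) G → ℂ := fun i => O ∘ torusConfigShift (v i) with hZ
  have hZm : ∀ i, Measurable (Z i) := fun i => hO.comp (torusConfigShift _).measurable
  have hZb : ∀ i U, ‖Z i U‖ ≤ B := fun i U => hB _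
  have hZd : ∀ i ∈ t, DependsOn (Z i) {e : Edge 4 (2 * S + 1) | 1 ≤ (e.1 0).val ∧ (e.1 0).val ≤ w} :=
    fun i hi => dependsOn_comp_torusConfigShift_spatial hOd (v i) (hv i hi)
  have hgoodShift : ∀ i ∈ t, ∀ n, n + w ≤ S - 1 →
      Good (Z i ∘ (⇑(torusTimeShift (G := G) (2 * S + 1) 1))^[n]) := by
    intro i hi n hn
    rw [Hankel.torusTimeShift_one_iterate]
    refine ⟨(hZm i).comp (torusTimeShift _ _).measurable, ⟨B, fun U => hZb i _⟩, ?_⟩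
    have h1 := Hankel.dependsOn_comp_torusTimeShift (hZd i hi) n (by omega)
    exact h1.mono (HankelSite.slab_subset_slab (by omega) (by omega))
  have hZgood : ∀ i ∈ t, Good (Z i) := fun i hi => by simpa using hgoodShift i hi 0 (by omega)
  -- invariance under the spatial translations: both factors reduce to the pair `(O, O)`
  have hshift : ∀ i ∈ t, ∀ n : ℕ,
      osCorr μ GaugeConfig.negReflect ((⇑(torusTimeShift (G := G) (2 * S + 1) 1))^[n]) (Z i) (Z i) =
        osCorr μ GaugeConfig.negReflect (torusTimeShift (2 * S + 1) n) O O := by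
    intro i hi n
    rw [Hankel.torusTimeShift_one_iterate]
    have hg : MeasurePreserving (⇑(torusConfigShift (G := G) (v i))) μ μ :=
      ⟨(torusConfigShift _).measurable, wilsonMeasure_map_torusConfigShift ρ β _⟩
    exact osCorr_comp_comp_eq_of_comm hg hΘm (torusTimeShift _ _).measurable
      (fun U => negReflect_torusConfigShift_spatial (v i) (hv i hi) U)
      (fun U => torusTimeShift_torusConfigShift n (v i) U) hO hO
  have hvarZ : ∀ i ∈ t, osVar μ GaugeConfig.negReflect (Z i) ≤ C := by
    intro i hi
    unfold osVar
    have h := hshift i hi 0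
    simp only [Function.iterate_zero] at h
    rw [h]
    refine (Complex.re_le_norm _).trans ?_
    have h0 := hpair 0 (Nat.zero_le _)
    have hid : (⇑(torusTimeShift (G := G) (2 * S + 1) 0)) = id := funext (torusTimeShift_zero_apply _)
    simp only [CharP.cast_eq_zero, mul_zero, neg_zero, Real.exp_zero, mul_one, hid] at h0
    rw [hid]
    simpa [hid] using h0
  -- each cross term
  have hterm : ∀ i ∈ t, ∀ j ∈ t,
      ‖osCorr μ GaugeConfig.negReflect (torusTimeShift (2 * S + 1) m)
          (Z i ∘ torusTimeShift (2 * S + 1) (s i)) (Z j ∘ torusTimeShift (2 * S + 1) (s j))‖ ≤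
        C * Real.exp (-(κ * m)) := by
    intro i hi j hj
    have hsi := hs i hi
    have hsj := hs j hj
    rw [← Hankel.torusTimeShift_one_iterate m, ← Hankel.torusTimeShift_one_iterate (s i),
      ← Hankel.torusTimeShift_one_iterate (s j),
      osCorr_iterate_comp_iterate hΘm hτ hσ hΘτ hστ (hZm i) (hZm j) m (s i) (s j)]
    -- polarised Cauchy–Schwarz at separations `(0, 2(m + s i + s j))`
    have hcs := norm_osCorr_iterate_sq_le hΘm hΘ hΘΘ hτ hσ hΘτ hστ hmeas hbdd hadd hvar
      (hZgood i hi) (hZgood j hj) (m + s i + s j) (hgoodShift j hj _ (by omega))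
    rw [hshift j hj] at hcs
    have hfar := hpair (2 * (m + s i + s j)) (by omega)
    have hre : (osCorr μ GaugeConfig.negReflect (torusTimeShift (2 * S + 1) (2 * (m + s i + s j))) O O).re
        ≤ C * Real.exp (-(κ * m)) ^ 2 := by
      refine ((Complex.re_le_norm _).trans hfar).trans (mul_le_mul_of_nonneg_left ?_ hC)
      rw [← Real.exp_nat_mul, Real.exp_le_exp]
      push_cast
      nlinarith [Nat.cast_nonneg (α := ℝ) (s i), Nat.cast_nonneg (α := ℝ) (s j),
        Nat.cast_nonneg (α := ℝ) m]
    have hV0 : 0 ≤ osVar μ GaugeConfig.negReflect (Z i) := hvar _ (hZgood i hi)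
    have hsq : ‖osCorr μ GaugeConfig.negReflect ((⇑(torusTimeShift (G := G) (2 * S + 1) 1))^[m + s i + s j])
        (Z i) (Z j)‖ ^ 2 ≤ (C * Real.exp (-(κ * m))) ^ 2 :=
      hcs.trans (((mul_le_mul_of_nonneg_left hre hV0).trans
        (mul_le_mul_of_nonneg_right (hvarZ i hi) (by positivity))).trans_eq (by ring))
    exact (pow_le_pow_iff_left₀ (norm_nonneg _) (by positivity) two_ne_zero).1 hsq
  -- sesquilinear expansion and summation of the cross-term bounds
  have hWm : ∀ i ∈ t, Measurable (O ∘ torusConfigShift (v i) ∘ torusTimeShift (2 * S + 1) (s i)) :=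
    fun i _ => (hZm i).comp (torusTimeShift _ _).measurable
  have hWb : ∀ i ∈ t, ∃ B', ∀ U, ‖(O ∘ torusConfigShift (v i) ∘ torusTimeShift (2 * S + 1) (s i)) U‖ ≤ B' :=
    fun i _ => ⟨B, fun U => hB _⟩
  rw [osCorr_sum_sum hΘm (torusTimeShift _ m).measurable t t a hWm hWb a hWm hWb]
  set T : ι → ι → ℂ := fun i j => conj (a i) * a j *
    osCorr μ GaugeConfig.negReflect (torusTimeShift (2 * S + 1) m)
      (O ∘ torusConfigShift (v i) ∘ torusTimeShift (2 * S + 1) (s i))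
      (O ∘ torusConfigShift (v j) ∘ torusTimeShift (2 * S + 1) (s j)) with hT
  have hTle : ∀ i ∈ t, ∀ j ∈ t, ‖T i j‖ ≤ ‖a i‖ * ‖a j‖ * (C * Real.exp (-(κ * m))) := by
    intro i hi j hj
    simp only [hT]
    rw [norm_mul, norm_mul, RCLike.norm_conj]
    exact mul_le_mul_of_nonneg_left (hterm i hi j hj) (by positivity)
  calc ‖∑ i ∈ t, ∑ j ∈ t, T i j‖
      ≤ ∑ i ∈ t, ‖∑ j ∈ t, T i j‖ := norm_sum_le _ _
    _ ≤ ∑ i ∈ t, ∑ j ∈ t, ‖a i‖ * ‖a j‖ * (C * Real.exp (-(κ * m))) :=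
        Finset.sum_le_sum fun i hi => (norm_sum_le _ _).trans (Finset.sum_le_sum fun j hj => hTle i hi j hj)
    _ = (∑ i ∈ t, ∑ j ∈ t, ‖a i‖ * ‖a j‖) * (C * Real.exp (-(κ * m))) := by
        rw [Finset.sum_mul]
        exact Finset.sum_congr rfl fun i _ => by rw [Finset.sum_mul]
    _ = (∑ i ∈ t, ‖a i‖) ^ 2 * C * Real.exp (-(κ * m)) := by
        rw [← Finset.sum_mul_sum, sq]; ring

/-- **The far bound at `0 ≤ β`** (reflection positivity discharged): on the odd Wilson torus of side
`2S+1` at inverse coupling `0 ≤ β`, site reflection positivity holds for slab observables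
(`stub_negReflectRP`, the sibling crux's landed odd-torus RP), so `norm_osCorr_combination_le`
applies unconditionally: ONE pair's clustering `‖osCorr μ Θ₀ τ_n O O‖ ≤ C e^{−κ n}`
(`n ≤ 2(m + 2 s̄)`) bounds the reflected autocorrelation of every finite combination of spatial
translates and forward time shifts of `O` by `(Σ_i ‖a_i‖)² C e^{−κ m}`. -/
theorem norm_osCorr_combination_le_of_nonneg (hρ : Continuous ρ) {β : ℝ} (hβ : 0 ≤ β)
    {O : GaugeConfig 4 (2 * S + 1) G → ℂ} (hO : Measurable O) (hOb : ∃ B, ∀ U, ‖O U‖ ≤ B) {w : ℕ}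
    (hOd : DependsOn O {e : Edge 4 (2 * S + 1) | 1 ≤ (e.1 0).val ∧ (e.1 0).val ≤ w})
    {ι : Type*} (t : Finset ι) (a : ι → ℂ) (v : ι → Site 4 (2 * S + 1)) (hv : ∀ i ∈ t, v i 0 = 0)
    (s : ι → ℕ) {smax : ℕ} (hs : ∀ i ∈ t, s i ≤ smax) {C κ : ℝ} (hC : 0 ≤ C) (hκ : 0 ≤ κ) {m : ℕ}
    (hrange : 2 * (m + 2 * smax) + w < S)
    (hpair : ∀ n, n ≤ 2 * (m + 2 * smax) →
      ‖osCorr (wilsonMeasure (d := 4) (L := 2 * S + 1) ρ β) GaugeConfig.negReflect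
          (torusTimeShift (2 * S + 1) n) O O‖ ≤ C * Real.exp (-(κ * n))) :
    ‖osCorr (wilsonMeasure (d := 4) (L := 2 * S + 1) ρ β) GaugeConfig.negReflect
        (torusTimeShift (2 * S + 1) m)
        (∑ i ∈ t, a i • (O ∘ torusConfigShift (v i) ∘ torusTimeShift (2 * S + 1) (s i)))
        (∑ i ∈ t, a i • (O ∘ torusConfigShift (v i) ∘ torusTimeShift (2 * S + 1) (s i)))‖ ≤
      (∑ i ∈ t, ‖a i‖) ^ 2 * C * Real.exp (-(κ * m)) :=
  norm_osCorr_combination_le ρ hρ β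
    (fun F hF hFb _ hw hdep =>
      Summit.QuantumFields.YangMills.Cruxes.LatticeGapOnTrajectory.OrbitKantorovichFiniteSize.stub_negReflectRP
        ρ hρ hβ (by omega) F hF hFb hw hdep)
    hO hOb hOd t a v hv s hs hC hκ hrange hpair

/-- **Registered sub-goal `stub_oneLegFarBound`** of crux `GapToContinuum` (line lead c10): the statement of
`norm_osCorr_combination_le_of_nonneg` at index universe `0`, verbatim as registered on the item. -/
theorem stub_oneLegFarBound :
    ∀ {G : Type} [Group G] [TopologicalSpace G] [IsTopologicalGroup G] [CompactSpace G] [MeasurableSpace G]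
      [BorelSpace G] {N : ℕ} (ρ : G →* Matrix (Fin N) (Fin N) ℂ) {S : ℕ}, Continuous ρ → ∀ {β : ℝ}, 0 ≤ β →
      ∀ {O : GaugeConfig 4 (2 * S + 1) G → ℂ}, Measurable O → (∃ B : ℝ, ∀ U, ‖O U‖ ≤ B) →
      ∀ {w : ℕ}, DependsOn O {e : Edge 4 (2 * S + 1) | 1 ≤ (e.1 0).val ∧ (e.1 0).val ≤ w} →
      ∀ {ι : Type} (t : Finset ι) (a : ι → ℂ) (v : ι → Site 4 (2 * S + 1)), (∀ i ∈ t, v i 0 = 0) →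
      ∀ (s : ι → ℕ) {smax : ℕ}, (∀ i ∈ t, s i ≤ smax) → ∀ {C κ : ℝ}, 0 ≤ C → 0 ≤ κ → ∀ {m : ℕ},
      2 * (m + 2 * smax) + w < S →
      (∀ n, n ≤ 2 * (m + 2 * smax) →
        ‖osCorr (wilsonMeasure (d := 4) (L := 2 * S + 1) ρ β) GaugeConfig.negReflect
            (torusTimeShift (2 * S + 1) n) O O‖ ≤ C * Real.exp (-(κ * n))) →
      ‖osCorr (wilsonMeasure (d := 4) (L := 2 * S + 1) ρ β) GaugeConfig.negReflect
          (torusTimeShift (2 * S + 1) m)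
          (∑ i ∈ t, a i • (O ∘ torusConfigShift (v i) ∘ torusTimeShift (2 * S + 1) (s i)))
          (∑ i ∈ t, a i • (O ∘ torusConfigShift (v i) ∘ torusTimeShift (2 * S + 1) (s i)))‖ ≤
        (∑ i ∈ t, ‖a i‖) ^ 2 * C * Real.exp (-(κ * m)) := by
  intro G _ _ _ _ _ _ N ρ S hρ β hβ O hO hOb w hOd ι t a v hv s smax hs C κ hC hκ m hrange hpair
  exact norm_osCorr_combination_le_of_nonneg ρ hρ hβ hO hOb hOd t a v hv s hs hC hκ hrange hpair

end Main

end Torus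

end Summit.QuantumFields.YangMills.Theorems.GapToContinuum.OneLeg

end
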